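import Summits.Langlands.Langlands.Theorems.RationalPeriodQuarterHeckePreservesRationalPeriodsDefs
import Literature.NumberTheory.Automorphic.BLZPeriodCocycleCollar

/-!
# Hecke stability of the rational period structure — part 2/4: the main computation and the assembly
(crux `RationalPeriodQuarter.HeckePreservesRationalPeriods`, item stmt-Langlands-2807)

Line-model bookkeeping (slash of finite sums/differences; `lineSlash_fun_neg` etc. are the library's), the three steps of the Hecke computation on period
cocycles (`step1`: unfolding `∫_{M_j γ⁻¹ i}^{M_j i}` along `M_j γ⁻¹ = δ M_k` by path additivity and
`Γ`-equivariance; `step2`: slash by `M_j` and substitute the rational-class decomposition; `step3`: sum over the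
`p + 1` matrices and re-index by the permutation), and the ASSEMBLY `heckePreservesRationalPeriods_of_subs :
HeckeStableQuarterForms → HeckeCosetPermutation → HeckePeriodIntertwining → HeckePreservesRationalPeriodsR`
(new rational-class data `q'_γ = Σ_j q_{δ_j⁻¹} | M_j`, `f' = Σ_j f|M_j − Σ_j F_j|M_j`; piecewise rationality,
semi-analyticity and the cocycle law by difference of cocycles — all from tree facts).
(Provenance: part 2/4 of the verbatim re-cut of the registered, sorry-free crux line
`Summits/Langlands/Langlands/Cruxes/HeckePreservesRationalPeriods/Lines/decomposition.lean`
(planner-cstrat-stmt-Langlands-2807-r1, 2026-08-17, sha256 41344dedc33c…; re-verified rc 0 / 0 sorry / std axioms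
2026-09-01) into `Theorems/` parts of at most 400 lines; namespace moved to `Theorems.HeckeRationalPeriods`, the
route-file import confined to part 4/4.  References: Bruggeman–Lewis–Zagier, Mem. AMS 1118 (2015) (2.25), (5.4)–(5.5a);
Diamond–Shurman GTM 228 Prop. 5.2.1; Mühlenbruch, J. Number Theory 118 (2006) 208–235.)
-/

noncomputable section

set_option linter.dupNamespace false

open scoped MatrixGroups Topology ComplexConjugate
open Filter Set

namespace Summit.Langlands.Langlands.Theorems.HeckeRationalPeriods

open Literature.NumberTheory.Automorphic UpperHalfPlane

/-! ## Line-model bookkeeping: slash of finite sums, cofinite identities -/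

section LineBookkeeping

/-- The line-model slash of a finite sum. -/
theorem lineSlash_finset_sum {ι : Type*} (S : Finset ι) (s : ℂ) (g : GL (Fin 2) ℝ) (φ : ι → ℝ → ℂ) (t : ℝ) :
    lineSlash s g (fun x => ∑ i ∈ S, φ i x) t = ∑ i ∈ S, lineSlash s g (φ i) t := by
  simp only [lineSlash_apply, Finset.mul_sum]

/-- The line-model slash of a difference. -/
theorem lineSlash_sub_apply (s : ℂ) (g : GL (Fin 2) ℝ) (φ ψ : ℝ → ℂ) (t : ℝ) :
    lineSlash s g (fun x => φ x - ψ x) t = lineSlash s g φ t - lineSlash s g ψ t := by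
  simp only [lineSlash_apply, mul_sub]

end LineBookkeeping

/-! ## The main computation: the Hecke operator on period cocycles -/

section Main

variable {N p : ℕ} (hp : p.Prime) (σ : SL(2, ℤ)) {u : ℍ → ℂ} (hu : IsQuarterCuspFormR N u)

/-- The base-point corrections `F_j = ∫_I^{M_j I} [u, R(t;·)^{1/2}]`. -/
def baseCorr (j : Fin (p + 1)) : ℝ → ℂ :=
  greenPeriod (1 / 2) u UpperHalfPlane.I (heckeGL σ hp j • UpperHalfPlane.I)

include hu in
/-- The base-point corrections are semi-analytic (indeed analytic: `isAnalyticVector_greenPeriod`). -/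
theorem isSemiAnalyticVector_baseCorr (j : Fin (p + 1)) : IsSemiAnalyticVector (baseCorr hp σ (u := u) j) :=
  (isAnalyticVector_greenPeriod (1 / 2) hu.1 _ _).isSemiAnalyticVector

/-- `(mapGL δ⁻¹)⁻¹ = mapGL δ`. -/
theorem mapGL_inv_inv (δ : SL(2, ℤ)) :
    (Matrix.SpecialLinearGroup.mapGL ℝ δ⁻¹)⁻¹ = Matrix.SpecialLinearGroup.mapGL ℝ δ := by
  rw [map_inv, inv_inv]

include hu in
/-- Step 1 (pointwise, off the pole of `δ⁻¹`): unfolding `∫_{M_j γ⁻¹ I}^{M_j I}` along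
`M_j γ⁻¹ = δ M_k` by path additivity and `Γ`-equivariance. -/
theorem step1 {γ δ : SL(2, ℤ)} (hδ : δ ∈ CongruenceSubgroup.Gamma1 N) {j k : Fin (p + 1)}
    (h : heckeMat p σ j * ((γ⁻¹ : SL(2, ℤ)) : Matrix (Fin 2) (Fin 2) ℤ) =
      (δ : Matrix (Fin 2) (Fin 2) ℤ) * heckeMat p σ k)
    {t : ℝ} (ht : (Matrix.SpecialLinearGroup.mapGL ℝ δ⁻¹) 1 0 * t +
      (Matrix.SpecialLinearGroup.mapGL ℝ δ⁻¹) 1 1 ≠ 0) :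
    greenPeriod (1 / 2) u (heckeGL σ hp j • (γ⁻¹ • UpperHalfPlane.I)) (heckeGL σ hp j • UpperHalfPlane.I) t =
      -(lineSlash (1 / 2) (Matrix.SpecialLinearGroup.mapGL ℝ δ⁻¹) (baseCorr hp σ (u := u) k) t) +
        lewisZagierCocycle (1 / 2) UpperHalfPlane.I u (Matrix.SpecialLinearGroup.mapGL ℝ δ⁻¹) t +
        baseCorr hp σ (u := u) j t := by
  have hue := isInvariantEigenfunction_of_isQuarterCuspFormR hu
  set I := UpperHalfPlane.I
  set Mj := heckeGL σ hp j
  set Mk := heckeGL σ hp k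
  set D := Matrix.SpecialLinearGroup.mapGL ℝ δ with hD
  -- the endpoint `M_j γ⁻¹ I = δ M_k I`
  have e1 : Mj • (γ⁻¹ • I) = D • (Mk • I) := by
    rw [sl_smul_eq_mapGL_smul, ← mul_smul, heckeGL_mul_eq σ hp h, mul_smul]
  rw [e1]
  -- path additivity: `∫_{δ M_k I}^{M_j I} = ∫_{δ M_k I}^{δ I} + ∫_{δ I}^{I} + ∫_I^{M_j I}`
  have add1 := greenPeriod_add hue one_half_ne_zero' one_half_ne_one' t (D • (Mk • I)) (D • I) (Mj • I)
  have add2 := greenPeriod_add hue one_half_ne_zero' one_half_ne_one' t (D • I) I (Mj • I)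
  rw [← add1, ← add2]
  -- first term: `Γ`-equivariance
  have hDinv : Matrix.SpecialLinearGroup.mapGL ℝ δ⁻¹ ∈ Gamma1GL N := mapGL_mem_Gamma1GL (inv_mem hδ)
  have t1 := lineSlash_greenPeriod hue one_half_ne_zero' one_half_ne_one' hDinv (Mk • I) I ht
  rw [mapGL_inv_inv] at t1
  have swap : greenPeriod (1 / 2) u (Mk • I) I = fun x => -(baseCorr hp σ (u := u) k x) := by
    funext x
    exact greenPeriod_swap hue one_half_ne_zero' one_half_ne_one' x I (Mk • I)
  rw [swap, lineSlash_fun_neg] at t1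
  rw [← hD] at t1
  rw [← t1]
  -- second term: the cocycle at `δ⁻¹`
  have t2 : greenPeriod (1 / 2) u (D • I) I t =
      lewisZagierCocycle (1 / 2) I u (Matrix.SpecialLinearGroup.mapGL ℝ δ⁻¹) t := by
    rw [lewisZagierCocycle, mapGL_inv_inv]
  rw [t2, ← add_assoc]
  rfl

/-- `slashHalf` by the `j`-th integer Hecke matrix is `lineSlash (1/2)` by `heckeGL j`. -/
theorem slashHalf_heckeMat (j : Fin (p + 1)) (φ : ℝ → ℂ) (t : ℝ) :
    Literature.NumberTheory.Automorphic.slashHalf (heckeMat p σ j) φ t = lineSlash (1 / 2) (heckeGL σ hp j) φ t :=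
  slashHalf_eq_lineSlash _ _ _ _

include hu in
/-- Step 2 (per `j`, off finite sets): slash by `M_j` and substitute the rational-class
decomposition `r_{δ⁻¹} ≡ q_{δ⁻¹} + f|δ⁻¹ - f`. -/
theorem step2 {γ δ : SL(2, ℤ)} (hδ : δ ∈ CongruenceSubgroup.Gamma1 N) {j k : Fin (p + 1)}
    (h : heckeMat p σ j * ((γ⁻¹ : SL(2, ℤ)) : Matrix (Fin 2) (Fin 2) ℤ) =
      (δ : Matrix (Fin 2) (Fin 2) ℤ) * heckeMat p σ k)
    {q : SL(2, ℤ) → ℝ → ℂ} {f : ℝ → ℂ}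
    (hqf : ∀ᶠ t in cofinite, lewisZagierCocycle (1 / 2) UpperHalfPlane.I u (Matrix.SpecialLinearGroup.mapGL ℝ δ⁻¹) t =
      q δ⁻¹ t + lineSlash (1 / 2) (Matrix.SpecialLinearGroup.mapGL ℝ δ⁻¹) f t - f t) :
    ∀ᶠ t in cofinite,
      lineSlash (1 / 2) (heckeGL σ hp j)
          (greenPeriod (1 / 2) u (heckeGL σ hp j • (γ⁻¹ • UpperHalfPlane.I)) (heckeGL σ hp j • UpperHalfPlane.I)) t =
        lineSlash (1 / 2) (heckeGL σ hp j) (q δ⁻¹) t +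
          lineSlash (1 / 2) (Matrix.SpecialLinearGroup.mapGL ℝ γ) (lineSlash (1 / 2) (heckeGL σ hp k) f) t -
          lineSlash (1 / 2) (heckeGL σ hp j) f t +
          lineSlash (1 / 2) (heckeGL σ hp j) (baseCorr hp σ (u := u) j) t -
          lineSlash (1 / 2) (Matrix.SpecialLinearGroup.mapGL ℝ γ)
            (lineSlash (1 / 2) (heckeGL σ hp k) (baseCorr hp σ (u := u) k)) t := by
  set I := UpperHalfPlane.I
  set Mj := heckeGL σ hp j with hMj
  set Mk := heckeGL σ hp k with hMk
  set D' := Matrix.SpecialLinearGroup.mapGL ℝ δ⁻¹ with hD'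
  set G := Matrix.SpecialLinearGroup.mapGL ℝ γ with hG
  -- the matrix identity `δ⁻¹ M_j = M_k γ` in `GL₂(ℝ)`
  have hmat : D' * Mj = Mk * G := by
    have e := heckeGL_mul_eq σ hp h
    rw [map_inv] at e
    rw [hD', map_inv, hMj, hMk, hG]
    calc (Matrix.SpecialLinearGroup.mapGL ℝ δ)⁻¹ * heckeGL σ hp j
        = (Matrix.SpecialLinearGroup.mapGL ℝ δ)⁻¹ * (heckeGL σ hp j * (Matrix.SpecialLinearGroup.mapGL ℝ γ)⁻¹) *
            Matrix.SpecialLinearGroup.mapGL ℝ γ := by group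
      _ = heckeGL σ hp k * Matrix.SpecialLinearGroup.mapGL ℝ γ := by rw [e]; group
  -- Step 1 off the pole of `δ⁻¹`, combined with `hqf`
  have A : ∀ᶠ t in cofinite,
      greenPeriod (1 / 2) u (Mj • (γ⁻¹ • I)) (Mj • I) t =
        -(lineSlash (1 / 2) D' (baseCorr hp σ (u := u) k) t) +
          (q δ⁻¹ t + lineSlash (1 / 2) D' f t - f t) + baseCorr hp σ (u := u) j t := by
    filter_upwards [eventually_cofinite_ne_linePole D', hqf] with t ht hq
    rw [step1 hp σ hu hδ h ht, hq]
  have B := lineSlash_congr_cofinite (1 / 2) Mj A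
  filter_upwards [B, eventually_cofinite_ne_linePole Mj, eventually_cofinite_ne_linePole G] with t hB hpMj hpG
  rw [hB]
  -- linearity of the slash
  have lin : lineSlash (1 / 2) Mj (fun t => -(lineSlash (1 / 2) D' (baseCorr hp σ (u := u) k) t) +
        (q δ⁻¹ t + lineSlash (1 / 2) D' f t - f t) + baseCorr hp σ (u := u) j t) t =
      -(lineSlash (1 / 2) Mj (lineSlash (1 / 2) D' (baseCorr hp σ (u := u) k)) t) +
        (lineSlash (1 / 2) Mj (q δ⁻¹) t + lineSlash (1 / 2) Mj (lineSlash (1 / 2) D' f) t -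
          lineSlash (1 / 2) Mj f t) + lineSlash (1 / 2) Mj (baseCorr hp σ (u := u) j) t := by
    simp only [lineSlash_apply]; ring
  rw [lin]
  -- `(φ | δ⁻¹) | M_j = φ | (δ⁻¹ M_j) = φ | (M_k γ) = (φ | M_k) | γ`
  have comp : ∀ φ : ℝ → ℂ, lineSlash (1 / 2) Mj (lineSlash (1 / 2) D' φ) t =
      lineSlash (1 / 2) G (lineSlash (1 / 2) Mk φ) t := fun φ => by
    rw [← lineSlash_mul (1 / 2) D' Mj φ hpMj, hmat, lineSlash_mul (1 / 2) Mk G φ hpG]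
  rw [comp, comp]
  ring

include hu in
/-- Step 3 (summed over the `p + 1` matrices, off finite sets). -/
theorem step3 {γ : SL(2, ℤ)} (e : Equiv.Perm (Fin (p + 1))) (δ : Fin (p + 1) → SL(2, ℤ))
    (hδ : ∀ j, δ j ∈ CongruenceSubgroup.Gamma1 N ∧
      heckeMat p σ j * ((γ⁻¹ : SL(2, ℤ)) : Matrix (Fin 2) (Fin 2) ℤ) =
        (δ j : Matrix (Fin 2) (Fin 2) ℤ) * heckeMat p σ (e j))
    {q : SL(2, ℤ) → ℝ → ℂ} {f : ℝ → ℂ}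
    (hqf : ∀ j, ∀ᶠ t in cofinite,
      lewisZagierCocycle (1 / 2) UpperHalfPlane.I u (Matrix.SpecialLinearGroup.mapGL ℝ (δ j)⁻¹) t =
        q (δ j)⁻¹ t + lineSlash (1 / 2) (Matrix.SpecialLinearGroup.mapGL ℝ (δ j)⁻¹) f t - f t) :
    ∀ᶠ t in cofinite,
      ∑ j : Fin (p + 1), lineSlash (1 / 2) (heckeGL σ hp j)
          (greenPeriod (1 / 2) u (heckeGL σ hp j • (γ⁻¹ • UpperHalfPlane.I)) (heckeGL σ hp j • UpperHalfPlane.I)) t =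
        (∑ j : Fin (p + 1), lineSlash (1 / 2) (heckeGL σ hp j) (q (δ j)⁻¹) t) +
          (lineSlash (1 / 2) (Matrix.SpecialLinearGroup.mapGL ℝ γ)
              (fun x => ∑ j : Fin (p + 1), lineSlash (1 / 2) (heckeGL σ hp j) f x -
                ∑ j : Fin (p + 1), lineSlash (1 / 2) (heckeGL σ hp j) (baseCorr hp σ (u := u) j) x) t -
            (∑ j : Fin (p + 1), lineSlash (1 / 2) (heckeGL σ hp j) f t -
              ∑ j : Fin (p + 1), lineSlash (1 / 2) (heckeGL σ hp j) (baseCorr hp σ (u := u) j) t)) := by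
  have hall : ∀ᶠ t in cofinite, ∀ j : Fin (p + 1),
      lineSlash (1 / 2) (heckeGL σ hp j)
          (greenPeriod (1 / 2) u (heckeGL σ hp j • (γ⁻¹ • UpperHalfPlane.I)) (heckeGL σ hp j • UpperHalfPlane.I)) t =
        lineSlash (1 / 2) (heckeGL σ hp j) (q (δ j)⁻¹) t +
          lineSlash (1 / 2) (Matrix.SpecialLinearGroup.mapGL ℝ γ) (lineSlash (1 / 2) (heckeGL σ hp (e j)) f) t -
          lineSlash (1 / 2) (heckeGL σ hp j) f t +
          lineSlash (1 / 2) (heckeGL σ hp j) (baseCorr hp σ (u := u) j) t -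
          lineSlash (1 / 2) (Matrix.SpecialLinearGroup.mapGL ℝ γ)
            (lineSlash (1 / 2) (heckeGL σ hp (e j)) (baseCorr hp σ (u := u) (e j))) t :=
    Filter.eventually_all.mpr fun j => step2 hp σ hu (hδ j).1 (hδ j).2 (hqf j)
  filter_upwards [hall] with t ht
  rw [Finset.sum_congr rfl fun j _ => ht j]
  simp only [Finset.sum_add_distrib, Finset.sum_sub_distrib, lineSlash_sub_apply, lineSlash_finset_sum]
  rw [Equiv.sum_comp e (fun i => lineSlash (1 / 2) (Matrix.SpecialLinearGroup.mapGL ℝ γ)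
      (lineSlash (1 / 2) (heckeGL σ hp i) f) t),
    Equiv.sum_comp e (fun i => lineSlash (1 / 2) (Matrix.SpecialLinearGroup.mapGL ℝ γ)
      (lineSlash (1 / 2) (heckeGL σ hp i) (baseCorr hp σ (u := u) i)) t)]
  ring

end Main

/-! ## The assembly -/

section Assembly

/-- Finite sums of functions, applied. -/
theorem sum_fn_eq {ι : Type*} (S : Finset ι) (g : ι → ℝ → ℂ) :
    (fun x => ∑ i ∈ S, g i x) = ∑ i ∈ S, g i := by
  funext x; simp [Finset.sum_apply]

/-- **Assembly**: `HeckeStableQuarterForms → HeckeCosetPermutation → HeckePeriodIntertwining →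
HeckePreservesRationalPeriods`. Given the rational-class data `(q, f)` of `u` and, for each
`γ ∈ Γ₁(N)`, the permutation data `M_j γ⁻¹ = δ_j M_{e j}` (piece 2), the Hecke translate
`T'_p u` has the rational-class data `q'_γ = Σ_j q_{δ_j⁻¹} | M_j` (piecewise rational: `PR_ℚ` is
stable under the determinant-free slash of integer matrices and sums — tree facts) and
`f' = Σ_j f | M_j - Σ_j F_j | M_j` with the base-point corrections `F_j = ∫_I^{M_j I}` (semi-analytic:
tree facts); the identity `r^{T'u}_γ ≡ q'_γ + f'|γ - f'` is piece 3 (intertwining) unfolded by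
path additivity and `Γ`-equivariance of the period integral (tree) along piece 2, and the cocycle
law of `q'` follows from that of `r^{T'u}` (tree, using piece 1) by difference of cocycles. -/
theorem heckePreservesRationalPeriods_of_subs : HeckePreservesRationalPeriodsOfSubs := by
  classical
  intro hX1 hX2 hX3
  replace hX1 := heckeStableQuarterForms_iff.mp hX1
  replace hX2 := heckeCosetPermutation_iff.mp hX2
  replace hX3 := heckePeriodIntertwining_iff.mp hX3
  show HeckePreservesRationalPeriodsR
  intro N hN p hp hpN σ hσ hσp u hu hr
  have huT : IsQuarterCuspFormR N (heckeT p σ u) := hX1 N hN p hp hpN σ hσ hσp u hu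
  refine ⟨huT, ?_⟩
  obtain ⟨q, f, hqPR, hqcoc, hfsa, hqf⟩ := hr
  choose e δ hδ using hX2 N hN p hp hpN σ hσ hσp
  have hueT := isInvariantEigenfunction_of_isQuarterCuspFormR huT
  -- the new data
  set fT : ℝ → ℂ := fun x => ∑ j : Fin (p + 1), lineSlash (1 / 2) (heckeGL σ hp j) f x -
    ∑ j : Fin (p + 1), lineSlash (1 / 2) (heckeGL σ hp j) (baseCorr hp σ (u := u) j) x with hfT
  set q' : SL(2, ℤ) → ℝ → ℂ := fun γ x => if hγ : γ ∈ CongruenceSubgroup.Gamma1 N then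
    ∑ j : Fin (p + 1), lineSlash (1 / 2) (heckeGL σ hp j) (q (δ γ⁻¹ (inv_mem hγ) j)⁻¹) x else 0 with hq'
  -- the rational-class identity of `u`, in library form
  have hqf' : ∀ η ∈ CongruenceSubgroup.Gamma1 N, ∀ᶠ t in cofinite,
      lewisZagierCocycle (1 / 2) UpperHalfPlane.I u (Matrix.SpecialLinearGroup.mapGL ℝ η) t =
        q η t + lineSlash (1 / 2) (Matrix.SpecialLinearGroup.mapGL ℝ η) f t - f t := by
    intro η hη
    have h := hqf η hη
    simp only [lzCocycleR_eq, slashHalfR_eq_lineSlash] at h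
    exact h
  -- MAIN IDENTITY: `r^{T'u}_γ ≡ q'_γ + f'|γ - f'`
  have mainId : ∀ γ (hγ : γ ∈ CongruenceSubgroup.Gamma1 N), ∀ᶠ t in cofinite,
      lewisZagierCocycle (1 / 2) UpperHalfPlane.I (heckeT p σ u) (Matrix.SpecialLinearGroup.mapGL ℝ γ) t =
        q' γ t + lineSlash (1 / 2) (Matrix.SpecialLinearGroup.mapGL ℝ γ) fT t - fT t := by
    intro γ hγ
    have h3 := hX3 N hN p hp hpN σ hσ hσp u hu γ
    have hS := step3 hp σ hu (γ := γ) (e γ⁻¹ (inv_mem hγ)) (δ γ⁻¹ (inv_mem hγ))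
      (hδ γ⁻¹ (inv_mem hγ)) (q := q) (f := f)
      (fun j => hqf' _ (inv_mem ((hδ γ⁻¹ (inv_mem hγ) j).1)))
    filter_upwards [h3, hS] with t h3t hSt
    rw [h3t]
    simp only [slashHalf_heckeMat hp σ, heckeAct_eq_smul σ hp] 
    rw [hSt, hq']
    simp only [dif_pos hγ]
    rw [hfT]
    ring
  refine ⟨q', fT, ?_, ?_, ?_, ?_⟩
  · -- `q'_γ ∈ PR_ℚ`
    intro γ hγ
    rw [isPRQR_iff, hq']
    simp only [dif_pos hγ]
    rw [sum_fn_eq]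
    refine (piecewiseRational ℚ).sum_mem fun j _ => ?_
    rw [mem_piecewiseRational]
    have e1 : lineSlash (1 / 2) (heckeGL σ hp j) (q (δ γ⁻¹ (inv_mem hγ) j)⁻¹) =
        Literature.NumberTheory.Automorphic.slashHalf (heckeMat p σ j) (q (δ γ⁻¹ (inv_mem hγ) j)⁻¹) := by
      funext x; exact (slashHalf_heckeMat hp σ j _ x).symm
    rw [e1]
    exact ((isPRQR_iff _).mp (hqPR _ (inv_mem (hδ γ⁻¹ (inv_mem hγ) j).1))).slashHalf
      (heckeMat_det_ne_zero σ hp j)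
  · -- the cocycle law of `q'`, by difference of cocycles
    intro γ hγ γ' hγ'
    have hm := mainId γ hγ
    have hm' := mainId γ' hγ'
    have hmm := mainId (γ * γ') (mul_mem hγ hγ')
    have hcoc := lewisZagierCocycle_mul_cofinite hueT one_half_ne_zero' one_half_ne_one'
      (mapGL_mem_Gamma1GL hγ) (mapGL_mem_Gamma1GL hγ') UpperHalfPlane.I
    set G := Matrix.SpecialLinearGroup.mapGL ℝ γ with hG
    set D := Matrix.SpecialLinearGroup.mapGL ℝ γ' with hD
    have hq'γ : ∀ᶠ x in cofinite, q' γ x =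
        lewisZagierCocycle (1 / 2) UpperHalfPlane.I (heckeT p σ u) G x - lineSlash (1 / 2) G fT x + fT x :=
      hm.mono fun x hx => by rw [hx]; ring
    have hslash := lineSlash_congr_cofinite (1 / 2) D hq'γ
    rw [map_mul] at hmm
    filter_upwards [hm', hmm, hcoc, hslash, eventually_cofinite_ne_linePole D] with t h1 h2 h3 h4 h5
    rw [slashHalfR_eq_lineSlash, ← hD, h4]
    have lin : lineSlash (1 / 2) D (fun x =>
        lewisZagierCocycle (1 / 2) UpperHalfPlane.I (heckeT p σ u) G x - lineSlash (1 / 2) G fT x + fT x) t =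
        lineSlash (1 / 2) D (lewisZagierCocycle (1 / 2) UpperHalfPlane.I (heckeT p σ u) G) t -
          lineSlash (1 / 2) D (lineSlash (1 / 2) G fT) t + lineSlash (1 / 2) D fT t := by
      simp only [lineSlash_apply]; ring
    rw [lin, ← lineSlash_mul (1 / 2) G D fT h5]
    have e2 : q' (γ * γ') t = lewisZagierCocycle (1 / 2) UpperHalfPlane.I (heckeT p σ u) (G * D) t -
        lineSlash (1 / 2) (G * D) fT t + fT t := by rw [h2]; ring
    have e1 : q' γ' t = lewisZagierCocycle (1 / 2) UpperHalfPlane.I (heckeT p σ u) D t -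
        lineSlash (1 / 2) D fT t + fT t := by rw [h1]; ring
    rw [e2, e1, h3]
    ring
  · -- `f'` is semi-analytic
    rw [isSemiAnalyticR_iff, ← mem_semiAnalyticLineVectors, hfT]
    have e1 : (fun x => ∑ j : Fin (p + 1), lineSlash (1 / 2) (heckeGL σ hp j) f x -
        ∑ j : Fin (p + 1), lineSlash (1 / 2) (heckeGL σ hp j) (baseCorr hp σ (u := u) j) x) =
        (∑ j : Fin (p + 1), lineSlash (1 / 2) (heckeGL σ hp j) f) -
          ∑ j : Fin (p + 1), lineSlash (1 / 2) (heckeGL σ hp j) (baseCorr hp σ (u := u) j) := by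
      funext x; simp [Finset.sum_apply]
    rw [e1]
    refine Submodule.sub_mem _ (Submodule.sum_mem _ fun j _ => ?_) (Submodule.sum_mem _ fun j _ => ?_)
    · exact lineSlash_mem_semiAnalyticLineVectors _ _ ((mem_semiAnalyticLineVectors).mpr ((isSemiAnalyticR_iff f).mp hfsa))
    · exact lineSlash_mem_semiAnalyticLineVectors _ _ ((mem_semiAnalyticLineVectors).mpr (isSemiAnalyticVector_baseCorr hp σ hu j))
  · -- the identity itself, back in the route's notation
    intro γ hγ
    have hm := mainId γ hγ
    filter_upwards [hm] with t ht
    rw [lzCocycleR_eq, slashHalfR_eq_lineSlash]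
    exact ht

end Assembly

end Summit.Langlands.Langlands.Theorems.HeckeRationalPeriods
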